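import Summits.ResolutionOfSingularities.ResolutionOfSingularities.Theorems.FrobeniusClosingPatchingRelPerfectDepthSNCPointwiseTransport
import Summits.ResolutionOfSingularities.ResolutionOfSingularities.Theorems.FrobeniusClosingPatchingRelPerfectDepthSNCExchange
import Summits.ResolutionOfSingularities.ResolutionOfSingularities.Theorems.FrobeniusClosingPatchingRelPerfectDepthSepFormatStepLemmas
import HarnessLib

/-!
# Crux `PatchingRelPerfect` (stmt-ResolutionOfSingularities-16161), chain W5.2 — F7(β) (β-AX): INV-H-STEP₁, STATE-FREE form for the cures

[OURS · L1 W5.2 · F7(β) (β-AX) · res-L1-w52-plan-1 CORRECTION G12-44 (b) naming «the STATE-FREE form of the same step for the CURES, which blow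
up `CentreSeq` centres inside the carrier and have no `MultiHostState.step`»] res-L1-w52-stub-1 g5.  Replaces the role of NO printed item; NOT a
statement of the manuscript under review (AI-written, weaker than expert review).  Sibling of `…DepthPhaseCHostSncStep` (p568006).

* **`sncWithAt_carrier_step`** — letters `𝓛` snc with the regular centre `W` (`HasSNCWith 𝓛 (vanishingIdeal W)`), a carrier / host `G` with
  `G ≤ 𝓘(W)`, and `(𝓛 ++ [G])` snc at `x = τ x′`: then `(𝓛.map strict ++ [exceptional] ++ [strict G])` is snc at `x′` — for EVERY `x′` (over
  the centre: Kollár 3.104 Step 2.1 exchange + Def. 3.25 transport; off it: local isomorphism, inside `IsBlowup.sncWithAt_transform`).  No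
  order hypothesis is needed in the strict-transform currency.
* **`sncWithAt_carrier_step_controlled`** — the same with the weight-one CONTROLLED transform of `G` in place of its strict transform, for an
  effective Cartier `G` of order exactly one along the irreducible regular centre on a regular `X` (`strictTransformIdeal_eq_controlledTransform_one`).
Fact-free.
-/

-- `Summit.<Summit>.<Sub>.Theorems` with `Sub = Summit` (single-conjunct summit, D-0017)
set_option linter.dupNamespace false

noncomputable section

open CategoryTheory AlgebraicGeometry TopologicalSpace IsLocalRing
open Literature.AlgebraicGeometry.Resolution Scheme.IdealSheafData

namespace Summit.ResolutionOfSingularities.ResolutionOfSingularities.Theorems.DepthMultiHost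

universe u

variable {X X' : Scheme.{u}} [IsLocallyNoetherian X]

/-- [OURS · L1 W5.2 · F7(β) (β-AX) · INV-H-STEP₁, state-free] **A carrier/host containing the centre that is snc with the letters at
`x = τ x′` stays snc with the letters (strict transforms ++ the exceptional divisor) at `x′`**, in the strict-transform currency.
[cite: Kollar2007, 3.104 Step 2.1, Def. 3.25] -/
theorem sncWithAt_carrier_step (𝓛 : List X.IdealSheafData) (G : X.IdealSheafData) (W : Closeds X)
    (hsnc : HasSNCWith 𝓛 (vanishingIdeal W)) (hGW : G ≤ vanishingIdeal W) {τ : X' ⟶ X} (hτ : IsBlowup τ (vanishingIdeal W)) {x' : X'}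
    (h : DepthSNC.SNCWithAt (𝓛 ++ [G]) ⊤ (τ x')) :
    DepthSNC.SNCWithAt (𝓛.map (strictTransformIdeal τ (vanishingIdeal W)) ++ [(vanishingIdeal W).comap τ] ++
      [strictTransformIdeal τ (vanishingIdeal W) G]) ⊤ x' := by
  classical
  have hℬ : DepthSNC.SNCWithAt 𝓛 (vanishingIdeal W) (τ x') := hsnc.sncWithAt (τ x')
  have h' : DepthSNC.SNCWithAt (G :: 𝓛) ⊤ (τ x') := h.congr_mem fun D _ => by simp only [List.mem_cons, List.mem_append]; tauto
  have hcons : DepthSNC.SNCWithAt (G :: 𝓛) (vanishingIdeal W) (τ x') :=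
    hℬ.cons_of_stalkIdeal_le h' (stalkIdeal_mono hGW _) fun B hB _ => ⟨hB, Or.inl hB⟩
  refine (hτ.sncWithAt_transform x' hcons).congr_mem fun D _ => ?_
  simp only [List.map_cons, List.cons_append, List.mem_cons, List.mem_append, List.not_mem_nil, or_false, List.mem_map]
  constructor
  · rintro ((h | h) | h)
    exacts [Or.inr (Or.inl h), Or.inr (Or.inr h), Or.inl h]
  · rintro (h | h | h)
    exacts [Or.inr h, Or.inl (Or.inl h), Or.inl (Or.inr h)]

/-- [OURS · L1 W5.2 · F7(β) (β-AX) · INV-H-STEP₁, state-free, controlled-transform currency] The same with the weight-one CONTROLLED transform of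
an effective Cartier `G` of order exactly one at every point of the (regular, irreducible) centre on a regular `X`. [cite: Kollar2007, 3.30.2] -/
theorem sncWithAt_carrier_step_controlled [NoetherianSpace X] (hX : Scheme.IsRegular X) (𝓛 : List X.IdealSheafData) (G : X.IdealSheafData)
    (hG : IsEffectiveCartier G) (W : Closeds X) (hsnc : HasSNCWith 𝓛 (vanishingIdeal W)) (hW : Scheme.IsRegular (vanishingIdeal W).subscheme)
    {η : X} (hη : IsGenericPoint η (W : Set X)) (hord : ∀ y ∈ (W : Set X), idealOrder G y = 1) {τ : X' ⟶ X}
    (hτ : IsBlowup τ (vanishingIdeal W)) {x' : X'} (h : DepthSNC.SNCWithAt (𝓛 ++ [G]) ⊤ (τ x')) :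
    DepthSNC.SNCWithAt (𝓛.map (strictTransformIdeal τ (vanishingIdeal W)) ++ [(vanishingIdeal W).comap τ] ++
      [controlledTransform τ (vanishingIdeal W) G 1]) ⊤ x' := by
  have hGW : G ≤ vanishingIdeal W := le_support_iff_le_vanishingIdeal.mp fun y hy => by rw [← one_le_idealOrder_iff, hord y hy]
  have hWsupp : (((vanishingIdeal W).support : Closeds X) : Set X) = (W : Set X) := Scheme.IdealSheafData.coe_support_vanishingIdeal W
  have hconn : _root_.IsPreconnected ((vanishingIdeal W).support : Set X) := by
    rw [hWsupp]; exact hη.isIrreducible.isPreirreducible.isPreconnected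
  have hord' : ∀ y : X, y ∈ (vanishingIdeal W).support → ¬ stalkIdeal G y ≤ maximalIdeal (X.presheaf.stalk y) ^ 2 := by
    intro y hy h2
    have hyW : y ∈ (W : Set X) := by rw [← hWsupp]; exact hy
    have := (le_idealOrder_iff G y 2).mpr h2
    rw [hord y hyW] at this
    exact absurd this (by decide)
  rw [← DepthGraded.SepStep.strictTransformIdeal_eq_controlledTransform_one hX hW hconn hG hGW hG hGW hτ hord']
  exact sncWithAt_carrier_step 𝓛 G W hsnc hGW hτ h

end Summit.ResolutionOfSingularities.ResolutionOfSingularities.Theorems.DepthMultiHost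

end
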